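import Mathlib.LinearAlgebra.Eigenspace.Triangularizable
import Mathlib.LinearAlgebra.Basis.VectorSpace
import Mathlib.LinearAlgebra.FiniteDimensional.Lemmas
import Mathlib.LinearAlgebra.Dual.Lemmas
import Mathlib.LinearAlgebra.Dimension.Free
import Mathlib.FieldTheory.IsAlgClosed.Basic
import HarnessLib

/-!
# Two stable `k`-forms of an irreducible family of operators differ by a scalar

Let `K ⊇ k` be fields with `K` algebraically closed, `V` a finite-dimensional `K`-vector space
and `S` a set of `K`-linear operators on `V` acting **irreducibly** (no `S`-stable `K`-subspace
other than `0` and `V`). A `k`-*form* of `V` is the `k`-span `W₁ = k⟨b⟩` of a `K`-basis `b`;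
suppose it is `S`-stable (the matrices of the `s ∈ S` in the basis `b` have entries in `k`). Let
`W ⊆ V` be any non-zero `S`-stable `k`-subspace whose `k`-linearly independent families stay
`K`-linearly independent. Then **`W = μ⁻¹ • W₁` for a non-zero scalar `μ ∈ K`**
(`exists_smul_mem_span_of_stable`): an `S`-stable `k`-structure on an absolutely irreducible
representation is unique up to homothety.

Proof (Schur + descent): pick `w ∈ W ∖ 0` and a `k`-linear functional `f : K → k` not vanishing
on one `b`-coordinate of `w`; applying `f` to all `b`-coordinates gives a `k`-linear,
`S`-equivariant map `P₀ : V → W₁` (equivariance because the `s ∈ S` have `k`-rational matrices,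
`repr_apply_of_stable`). A `k`-basis of `W` is a `K`-basis of `V` (its `K`-span is `S`-stable
and non-zero), so `P₀|_W` extends to a `K`-linear `S`-equivariant `P : V → V`, which is a scalar
`μ` by Schur's lemma (`exists_eq_smul_id_of_irreducible`, `K` algebraically closed); `μ ≠ 0`
since `P w = P₀ w ≠ 0`. Hence `μ • W = P₀(W) ⊆ W₁`, with equality by counting `k`-dimensions.

This is the representation-theoretic input for the rationality of Hodge classes on complex tori
through an abstract natural de Rham comparison (both the rational singular classes and the
rational-period invariant forms are `GLₙ(ℤ)`-stable `ℚ`-forms of `H²(T; ℂ)`); it is the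
absolutely irreducible special case, with an elementary proof, of the Noether–Deuring theorem
(Curtis–Reiner (1962), §29, Thm. (29.7): modules isomorphic after an extension of the ground
field are isomorphic).

## References

* C. W. Curtis, I. Reiner, *Representation Theory of Finite Groups and Associative Algebras*,
  Interscience (1962), §27 (Schur's lemma), §29 (extension of the ground field; the
  Noether–Deuring theorem (29.7); absolutely irreducible modules). [CurtisReiner1962]
-/

noncomputable section

open Module Submodule

namespace Literature.RepresentationTheory.GeneralLinear

variable {k K : Type*} [Field k] [Field K] [Algebra k K]
  {V : Type*} [AddCommGroup V] [Module K V] [Module k V] [IsScalarTower k K V]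

/-- A `K`-subspace `U` is *stable* under the set of operators `S` if `s U ⊆ U` for all `s ∈ S`.
[folklore] -/
def IsStable (S : Set (V →ₗ[K] V)) (U : Submodule K V) : Prop :=
  ∀ s ∈ S, ∀ v ∈ U, s v ∈ U

/-- The set of operators `S` acts *irreducibly* on `V`: the only `S`-stable `K`-subspaces are `⊥`
and `⊤` (Curtis–Reiner (1962), §29). [cite: CurtisReiner1962, §29] -/
def IsIrreducible (S : Set (V →ₗ[K] V)) : Prop :=
  ∀ U : Submodule K V, IsStable S U → U = ⊥ ∨ U = ⊤

/-- **Schur's lemma** for an irreducible set of operators over an algebraically closed field: an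
operator commuting with every `s ∈ S` is a scalar (its eigenspace for an eigenvalue is `S`-stable
and non-zero). Curtis–Reiner (1962), §27. [cite: CurtisReiner1962, §27] -/
theorem exists_eq_smul_id_of_irreducible [IsAlgClosed K] [FiniteDimensional K V] [Nontrivial V]
    {S : Set (V →ₗ[K] V)} (hS : IsIrreducible S) (P : V →ₗ[K] V)
    (hP : ∀ s ∈ S, P ∘ₗ s = s ∘ₗ P) : ∃ c : K, P = c • LinearMap.id := by
  obtain ⟨c, hc⟩ := Module.End.exists_eigenvalue P
  refine ⟨c, ?_⟩
  have hst : IsStable S (Module.End.eigenspace P c) := by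
    intro s hs v hv
    rw [Module.End.mem_eigenspace_iff] at hv ⊢
    have h := congrArg (fun f : V →ₗ[K] V ↦ f v) (hP s hs)
    simp only [LinearMap.coe_comp, Function.comp_apply] at h
    rw [h, hv, map_smul]
  rcases hS _ hst with h | h
  · exact absurd h hc
  · ext v
    have hv : v ∈ Module.End.eigenspace P c := h ▸ Submodule.mem_top
    rw [Module.End.mem_eigenspace_iff] at hv
    simp [hv]

omit [Algebra k K] [IsScalarTower k K V] in
/-- The `K`-span of an `S`-stable `k`-subspace is `S`-stable. [folklore] -/
theorem isStable_span_of_stable {S : Set (V →ₗ[K] V)} {W : Submodule k V}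
    (hW : ∀ s ∈ S, ∀ v ∈ W, s v ∈ W) : IsStable S (Submodule.span K (W : Set V)) := by
  intro s hs v hv
  induction hv using Submodule.span_induction with
  | mem x hx => exact Submodule.subset_span (hW s hs x hx)
  | zero => simp
  | add x y _ _ hx hy => rw [map_add]; exact Submodule.add_mem _ hx hy
  | smul c x _ hx => rw [map_smul]; exact Submodule.smul_mem _ c hx

/-- **The matrix of a `k`-rational operator**: if `s (b j) ∈ k⟨b⟩` for all `j`, with entries
`M i j ∈ k` (`s (b j) = Σᵢ M i j • b i`), then the `b`-coordinates transform by `M`: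
`(s v)ᵢ = Σⱼ M i j · vⱼ`. [folklore] -/
theorem repr_apply_of_matrix {ι : Type*} [Fintype ι] (b : Basis ι K V) (s : V →ₗ[K] V)
    (M : ι → ι → k) (hM : ∀ j, (∑ i, M i j • b i) = s (b j)) (v : V) (i : ι) :
    b.repr (s v) i = ∑ j, algebraMap k K (M i j) * b.repr v j := by
  classical
  have hs : s v = ∑ j, b.repr v j • s (b j) := by
    conv_lhs => rw [← b.sum_repr v]
    rw [map_sum]
    simp_rw [map_smul]
  have hsb : ∀ j, b.repr (s (b j)) i = algebraMap k K (M i j) := by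
    intro j
    have h : ∀ i', b.repr (M i' j • b i') i = if i' = i then algebraMap k K (M i j) else 0 := by
      intro i'
      rw [← algebraMap_smul K (M i' j) (b i'), map_smul, Finsupp.smul_apply, b.repr_self,
        Finsupp.single_apply]
      split_ifs with h
      · subst h; simp
      · simp
    rw [← hM j, map_sum, Finsupp.finsetSum_apply]
    simp_rw [h]
    simp
  rw [hs, map_sum, Finsupp.finsetSum_apply]
  simp_rw [map_smul, Finsupp.smul_apply, hsb, smul_eq_mul, mul_comm]

/-- **Descent of stable `k`-forms.** Let `S` act irreducibly on the `K`-vector space `V` (`K`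
algebraically closed), let `b` be a `K`-basis whose `k`-span `W₁ = k⟨b⟩` is `S`-stable, and let
`W ≠ 0` be an `S`-stable `k`-subspace of `V` in which `k`-linear independence implies `K`-linear
independence. Then there is `μ ∈ Kˣ` with `μ • W ⊆ W₁` and `μ⁻¹ • W₁ ⊆ W`, i.e. `W = μ⁻¹ W₁`.
Curtis–Reiner (1962), §29 (uniqueness of `k`-structures on absolutely irreducible modules;
cf. the Noether–Deuring theorem (29.7)). [cite: CurtisReiner1962, §29] -/
theorem exists_smul_mem_span_of_stable [IsAlgClosed K] {ι : Type*} [Fintype ι] [Nonempty ι]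
    (b : Basis ι K V) {S : Set (V →ₗ[K] V)} (hS : IsIrreducible S)
    (h₁ : ∀ s ∈ S, ∀ i, s (b i) ∈ Submodule.span k (Set.range b))
    (W : Submodule k V) (hW : ∀ s ∈ S, ∀ v ∈ W, s v ∈ W) (hW0 : W ≠ ⊥)
    (hWind : ∀ (n : ℕ) (v : Fin n → W), LinearIndependent k v →
      LinearIndependent K (fun i ↦ (v i : V))) :
    ∃ μ : K, μ ≠ 0 ∧ (∀ y ∈ W, μ • y ∈ Submodule.span k (Set.range b)) ∧
      ∀ x ∈ Submodule.span k (Set.range b), μ⁻¹ • x ∈ W := by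
  classical
  haveI : FiniteDimensional K V := Module.Finite.of_basis b
  obtain ⟨i₁⟩ := ‹Nonempty ι›
  haveI : Nontrivial V := ⟨⟨b i₁, 0, b.ne_zero i₁⟩⟩
  set W₁ : Submodule k V := Submodule.span k (Set.range b) with hW₁
  -- (B) `W` is finite-dimensional over `k`
  haveI hWfin : Module.Finite k W := by
    rw [← Module.rank_lt_aleph0_iff]
    refine lt_of_le_of_lt (rank_le (n := Fintype.card ι) fun t ht ↦ ?_) (Cardinal.natCast_lt_aleph0 (n := Fintype.card ι))
    have hli : LinearIndependent k ((fun i : t ↦ (i : W)) ∘ t.equivFin.symm) :=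
      ht.comp _ t.equivFin.symm.injective
    have h := (hWind _ _ hli).fintype_card_le_finrank
    rwa [Fintype.card_fin, Module.finrank_eq_card_basis b] at h
  -- (C)-(D) a `k`-basis `u` of `W` is a `K`-basis of `V`
  set m := Module.finrank k W with hm
  let u : Basis (Fin m) k W := Module.finBasis k W
  have huK : LinearIndependent K (fun l ↦ (u l : V)) := hWind _ _ u.linearIndependent
  have hspanW : Submodule.span K (W : Set V) = ⊤ := by
    rcases hS _ (isStable_span_of_stable hW) with h | h
    · exfalso
      apply hW0
      rw [eq_bot_iff]
      intro v hv
      have : v ∈ Submodule.span K (W : Set V) := Submodule.subset_span hv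
      rw [h] at this
      exact this
    · exact h
  have hspan_u : ⊤ ≤ Submodule.span K (Set.range fun l ↦ (u l : V)) := by
    rw [← hspanW, Submodule.span_le]
    intro v hv
    have hv' : (⟨v, hv⟩ : W) ∈ Submodule.span k (Set.range u) := by rw [u.span_eq]; trivial
    have himg : (W.subtype '' (Submodule.span k (Set.range u) : Set W)) ⊆
        (Submodule.span K (Set.range fun l ↦ (u l : V)) : Set V) := by
      rw [Set.image_subset_iff]
      intro x hx
      simp only [Set.mem_preimage, SetLike.mem_coe]
      induction hx using Submodule.span_induction with
      | mem y hy =>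
        obtain ⟨l, rfl⟩ := hy
        exact Submodule.subset_span ⟨l, rfl⟩
      | zero => simp
      | add y z _ _ hy hz => simpa using Submodule.add_mem _ hy hz
      | smul c y _ hy =>
        simpa [algebraMap_smul] using Submodule.smul_mem _ (algebraMap k K c) hy
    exact himg ⟨⟨v, hv⟩, hv', rfl⟩
  let bu : Basis (Fin m) K V := Basis.mk huK hspan_u
  have hbu : ∀ l, bu l = (u l : V) := fun l ↦ Basis.mk_apply huK hspan_u l
  -- (E) a non-zero vector of `W` and a functional detecting one of its coordinates
  obtain ⟨w, hwW, hw0⟩ := (Submodule.ne_bot_iff W).1 hW0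
  obtain ⟨i₀, hi₀⟩ : ∃ i₀, b.repr w i₀ ≠ 0 := by
    by_contra h
    push Not at h
    exact hw0 (b.repr.injective (Finsupp.ext fun i ↦ by simpa using h i))
  obtain ⟨φ, hφ⟩ : ∃ φ : Module.Dual k K, φ (b.repr w i₀) ≠ 0 := by
    by_contra h
    push Not at h
    exact hi₀ ((Module.forall_dual_apply_eq_zero_iff k _).1 h)
  -- (F) the `k`-linear averaging map `P₀ v = Σᵢ φ(vᵢ) • b i`
  let P₀ : V →ₗ[k] V := ∑ i, (φ ∘ₗ (b.coord i).restrictScalars k).smulRight (b i)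
  have hP₀ : ∀ v, P₀ v = ∑ i, φ (b.repr v i) • b i := fun v ↦ by
    simp [P₀, LinearMap.sum_apply]
  have hP₀W₁ : ∀ v, P₀ v ∈ W₁ := fun v ↦ by
    rw [hP₀]
    exact Submodule.sum_mem _ fun i _ ↦ Submodule.smul_mem _ _ (Submodule.subset_span ⟨i, rfl⟩)
  have hP₀w : P₀ w ≠ 0 := by
    intro h
    have h2 := congrArg (fun v ↦ b.repr v i₀) h
    simp only [hP₀, map_sum, map_zero, Finsupp.coe_finsetSum, Finset.sum_apply,
      Finsupp.coe_zero, Pi.zero_apply] at h2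
    rw [Finset.sum_eq_single i₀] at h2
    · rw [← algebraMap_smul K (φ (b.repr w i₀)) (b i₀), map_smul, Finsupp.smul_apply, b.repr_self,
        Finsupp.single_eq_same, smul_eq_mul, mul_one] at h2
      exact hφ ((map_eq_zero_iff (algebraMap k K) (algebraMap k K).injective).1 h2)
    · intro i _ hi
      rw [← algebraMap_smul K (φ (b.repr w i)) (b i), map_smul, Finsupp.smul_apply, b.repr_self,
        Finsupp.single_apply, if_neg hi, smul_zero]
    · intro h'; exact absurd (Finset.mem_univ i₀) h'
  -- (F3) `P₀` is `S`-equivariant (the matrices of `S` are `k`-rational)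
  have hP₀eq : ∀ s ∈ S, ∀ v, P₀ (s v) = s (P₀ v) := by
    intro s hs v
    choose M hM using fun j ↦ (Submodule.mem_span_range_iff_exists_fun k).1 (h₁ s hs j)
    rw [hP₀, hP₀, map_sum]
    simp_rw [repr_apply_of_matrix b s (fun i j ↦ M j i) (fun j ↦ hM j) v, map_sum,
      LinearMap.map_smul_of_tower, ← hM, Finset.smul_sum]
    rw [Finset.sum_comm]
    refine Finset.sum_congr rfl fun i _ ↦ ?_
    rw [Finset.sum_smul]
    refine Finset.sum_congr rfl fun j _ ↦ ?_
    rw [← Algebra.smul_def, φ.map_smul, smul_smul, smul_eq_mul, mul_comm]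
  -- (G) the `K`-linear extension `P` of `P₀|_W`
  let P : V →ₗ[K] V := bu.constr K fun l ↦ P₀ (u l : V)
  have hPu : ∀ l, P (u l : V) = P₀ (u l : V) := fun l ↦ by
    have h := Basis.constr_basis bu K (fun l ↦ P₀ (u l : V)) l
    rw [hbu] at h
    exact h
  have hPW : ∀ y ∈ W, P y = P₀ y := by
    intro y hy
    -- two `k`-linear maps `W → V` agreeing on the basis `u`
    have h := (u.ext (f₁ := (P.restrictScalars k) ∘ₗ W.subtype) (f₂ := P₀ ∘ₗ W.subtype)
      fun l ↦ by simpa using hPu l)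
    exact congrArg (fun f : W →ₗ[k] V ↦ f ⟨y, hy⟩) h
  have hPeq : ∀ s ∈ S, P ∘ₗ s = s ∘ₗ P := by
    intro s hs
    refine bu.ext fun l ↦ ?_
    simp only [LinearMap.coe_comp, Function.comp_apply, hbu]
    rw [hPW _ (hW s hs _ (u l).2), hP₀eq s hs, hPu]
  -- (H) Schur
  obtain ⟨μ, hμ⟩ := exists_eq_smul_id_of_irreducible hS P hPeq
  have hμW : ∀ y ∈ W, μ • y = P₀ y := fun y hy ↦ by
    rw [← hPW y hy, hμ]
    rfl
  have hμ0 : μ ≠ 0 := by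
    intro h
    apply hP₀w
    rw [← hμW w hwW, h, zero_smul]
  refine ⟨μ, hμ0, fun y hy ↦ (hμW y hy).symm ▸ hP₀W₁ y, ?_⟩
  -- (J) the reverse inclusion by counting `k`-dimensions
  have hbk : LinearIndependent k b := b.linearIndependent.restrict_scalars' k
  haveI : FiniteDimensional k W₁ := FiniteDimensional.span_of_finite k (Set.finite_range b)
  let F : W →ₗ[k] W₁ :=
    { toFun := fun y ↦ ⟨μ • (y : V), (hμW y y.2).symm ▸ hP₀W₁ y⟩
      map_add' := fun y z ↦ by
        apply Subtype.ext
        change μ • ((y : V) + z) = μ • (y : V) + μ • (z : V)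
        exact smul_add _ _ _
      map_smul' := fun c y ↦ by
        apply Subtype.ext
        change μ • (c • (y : V)) = c • (μ • (y : V))
        exact smul_comm _ _ _ }
  have hFinj : Function.Injective F := by
    intro y z h
    have h2 : μ • (y : V) = μ • (z : V) := congrArg Subtype.val h
    exact Subtype.ext (smul_right_injective V hμ0 h2)
  have hdim : Module.finrank k W = Module.finrank k W₁ := by
    have h1 : Module.finrank k W₁ = Fintype.card ι := finrank_span_eq_card hbk
    have h2 : Fintype.card (Fin m) = Fintype.card ι := by
      rw [← Module.finrank_eq_card_basis bu, Module.finrank_eq_card_basis b]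
    rw [h1, ← h2, Fintype.card_fin]
  have hFsurj : Function.Surjective F :=
    (LinearMap.injective_iff_surjective_of_finrank_eq_finrank hdim).1 hFinj
  intro x hx
  obtain ⟨y, hy⟩ := hFsurj ⟨x, hx⟩
  have hyx : μ • (y : V) = x := congrArg Subtype.val hy
  rw [← hyx, smul_smul, inv_mul_cancel₀ hμ0, one_smul]
  exact y.2

end Literature.RepresentationTheory.GeneralLinear
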